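import Mathlib
import Literature.RingTheory.CohomologyAnnihilator.Basic
import Literature.RingTheory.CohomologyAnnihilator.AnnihilationOfCohomology
import Literature.RingTheory.CohomologyAnnihilator.ModuleDescentFiniteSubextension
import HarnessLib

/-!
# The cohomology annihilator and 𝔪-adic completion (Bahlekeh–Hakimian–Salarian–Takahashi)

Topic: `Literature/RingTheory/CohomologyAnnihilator`. Named facts and PROVED consequences comparing
the cohomology annihilator ideals `caⁿ(R)`, `ca(R)` (`Basic.lean`: `cohomologyAnnihilatorOfDegree`,
`cohomologyAnnihilator`, [IyengarTakahashi2014, Def. 2.1]) of a commutative noetherian local ring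
`(R, 𝔪)` with those of its `𝔪`-adic completion `R̂`, realised as Mathlib's
`AdicCompletion (IsLocalRing.maximalIdeal R) R` (a local ring with maximal ideal `𝔪R̂`,
`AdicCompletion.maximalIdeal_eq_map`).

* `IsIsolatedSingularity R` — [BahlekehHakimianSalarianTakahashi2015, Def. 2.2 (3)]: a local ring
  `(R, 𝔪)` is an isolated singularity if `R_𝔭` is regular for every non-maximal prime `𝔭`.
* `caCompletion_comap_le` — NAMED FACT, [BahlekehHakimianSalarianTakahashi2015, Thm. 4.5 (1)]:
  `caⁿ(R̂) ∩ R ⊆ caⁿ(R)` for every (noetherian) local ring `R` and every `n ≥ 0`.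
* `le_caCompletion_comap` — NAMED FACT, [BahlekehHakimianSalarianTakahashi2015, Thm. 4.5 (2)]:
  if `R̂` is an isolated singularity and `d = dim R` then `caⁿ(R) ⊆ caⁿ⁺ᵈ(R̂) ∩ R`.
* PROVED from the two facts: `cohomologyAnnihilator_eq_comap_completion` — "Hence
  `ca(R) = ca(R̂) ∩ R`" (Thm. 4.5 (2), second sentence); `exists_pow_le_cohomologyAnnihilator_iff` —
  "In particular, `ca(R)` is `𝔪`-primary if and only if `ca(R̂)` is `𝔪̂`-primary" (Thm. 4.5, last
  sentence; rendered as `∃ N, 𝔪ᴺ ⊆ ca`, i.e. primary-or-unit);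
  `cohomologyAnnihilator_completion_eq_map` — the extended-ideal form `ca(R̂) = ca(R)·R̂` when
  moreover `ca(R) ⊇ 𝔪ᴺ` (NOT printed in the source: it follows from Thm. 4.5 and the elementary
  `eq_map_comap_of_maximalIdeal_pow_le`, "an `𝔪̂`-primary ideal of `R̂` is extended from `R`"
  [Matsumura1987, §8 (3)–(4)], proved here from Mathlib's `AdicCompletion.pow_smul_top_eq_ker_eval`).
* PROVED, unconditional in the tree's Theorem 5.4 (`singEqVCa_essFiniteType_holds`):
  `exists_maximalIdeal_pow_le_cohomologyAnnihilator_of_essFiniteType` — a local ring essentially of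
  finite type over a field which is an isolated singularity has `𝔪`-primary-or-unit `ca`; and
  `cohomologyAnnihilator_completion_eq_map_of_essFiniteType` — for such `R` with `R̂` an isolated
  singularity, `ca(R̂) = ca(R)·R̂` and `ca(R) = ca(R̂) ∩ R` (modulo the two BHST facts). This is the
  "C-comp" transfer used by the specimen computations of crux chain W4.4
  (`Summits/ResolutionOfSingularities/…/Theses/HomologicalConductor`, items `NoZeno` / `NoZenoR`),
  which compute `ca` on the complete local ring and read it back on the algebraic one;
  `isIsolatedSingularity_of_isIntegrallyClosed_of_ringKrullDim_le_two` — PROVED: a normal noetherian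
  local domain of dimension `≤ 2` is an isolated singularity ([Matsumura1987, Thm. 11.2]: normal of
  dimension one ⇒ DVR), and the resulting `cohomologyAnnihilator_completion_eq_map_of_isIntegrallyClosed`
  for the normal two-dimensional stages of the route's `ca`-tower.

Conventions of the source (Convention 2.1): rings are commutative noetherian, modules finitely
generated, `caⁿ(R) = ann_R Ext^{≥ n}_R(mod R, mod R)` exactly as in [IyengarTakahashi2014, Def. 2.1]
(= `cohomologyAnnihilatorOfDegree`). "`d`-dimensional" is the Krull dimension of `R`
(`ringKrullDim R = d`). The hypothesis "`R̂` is an isolated singularity" of Thm. 4.5 (2) is kept as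
a hypothesis ON `R̂` (for an excellent `R` it is equivalent to `R` being an isolated singularity —
regular formal fibres, [Matsumura 1980, Thm. 79] — but that transfer is not recorded here).

Deliberately NOT here: [IyengarTakahashi2014, Thm. 5.3] (equicharacteristic excellent / complete
local rings: `V(ca) = Sing`), which would give `𝔪̂`-primarity of `ca(R̂)` directly upstairs — Mathlib
(this tree's version) has no `IsNoetherianRing (AdicCompletion I R)`, so a fact about noetherian
complete local rings could not be applied to `R̂`; the downstairs route through Theorem 5.4
(`exists_maximalIdeal_pow_le_cohomologyAnnihilator_of_essFiniteType`) needs nothing of the kind.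
No proof of Thm. 4.5 itself is attempted: (1) needs `Ext_R̂(M̂, N̂) ≅ Ext_R(M, N) ⊗ R̂` for finitely
generated `M`, `N` and purity of `R → R̂`; (2) needs the structure theorem [BHST15, Cor. 4.4] for
modules locally free on the punctured spectrum — none of which is in Mathlib.

CAVEAT: the statements of this file were typed by an AI seat from the arXiv text (v1 of
arXiv:1504.06163, pp. 10–11) and checked only by the Lean kernel for well-formedness; this is weaker
than expert review of the rendering.

## References

* A. Bahlekeh, E. Hakimian, S. Salarian, R. Takahashi, *Annihilation of cohomology, generation of
  modules and finiteness of derived dimension*, arXiv:1504.06163 (Q. J. Math. 2016): Def. 2.2,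
  Cor. 4.4, Thm. 4.5. [`BahlekehHakimianSalarianTakahashi2015`]
* S. B. Iyengar, R. Takahashi, *Annihilation of cohomology and strong generation of module
  categories*, arXiv:1404.1476 (IMRN 2016): Def. 2.1, Thm. 5.3, Thm. 5.4. [`IyengarTakahashi2014`]
* H. Matsumura, *Commutative Ring Theory*, Cambridge 1986/87: §8, summary (3)–(4) p. 63
  (`Â/𝔪ⁿÂ = A/𝔪ⁿ`, `IÂ ∩ A = I`). [`Matsumura1987`]
-/

noncomputable section

open IsLocalRing

universe u

namespace Literature.RingTheory.CohomologyAnnihilator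

/-! ## Isolated singularities -/

/-- A local ring `(R, 𝔪)` **is an isolated singularity** if `R_𝔭` is a regular local ring for every
non-maximal prime ideal `𝔭`, i.e. `Sing R ⊆ {𝔪}` with `Sing R = {𝔭 | R_𝔭 is not regular}`
(the source's Def. 2.2 (2)–(3); `R` itself may or may not be regular).
[cite: BahlekehHakimianSalarianTakahashi2015, Definition 2.2 (3)] -/
def IsIsolatedSingularity (R : Type u) [CommRing R] [IsLocalRing R] : Prop :=
  ∀ (𝔭 : Ideal R) [𝔭.IsPrime], 𝔭 ≠ maximalIdeal R → IsRegularLocalRing (Localization.AtPrime 𝔭)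

/-- Over a noetherian local ring which is an isolated singularity, an ideal `I` whose primes are all
singular (`I ⊆ 𝔭 ⇒ R_𝔭` not regular, i.e. `V(I) ⊆ Sing R`) contains a power of the maximal ideal:
`V(I) ⊆ Sing R ⊆ {𝔪}` forces `√I ⊇ 𝔪` (with `IsIsolatedSingularity`, the source's Def. 2.2 (3)).
Elementary; private helper used below with `I = ca(R)`. [folklore] -/
private theorem exists_maximalIdeal_pow_le_of_isIsolatedSingularity {R : Type u} [CommRing R]
    [IsNoetherianRing R] [IsLocalRing R] (hR : IsIsolatedSingularity R) {I : Ideal R}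
    (hI : ∀ (𝔭 : Ideal R) [𝔭.IsPrime], I ≤ 𝔭 → ¬ IsRegularLocalRing (Localization.AtPrime 𝔭)) :
    ∃ N : ℕ, maximalIdeal R ^ N ≤ I := by
  have hrad : maximalIdeal R ≤ I.radical := by
    rw [Ideal.radical_eq_sInf]
    refine le_sInf ?_
    rintro 𝔭 ⟨hIp, hp⟩
    by_cases h : 𝔭 = maximalIdeal R
    · exact h.ge
    · exact absurd (hR 𝔭 h) (hI 𝔭 hIp)
  exact Ideal.exists_pow_le_of_le_radical_of_fg hrad (maximalIdeal R).fg_of_isNoetherianRing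

/-! ## Extended ideals of the completion -/

/-- An ideal `J` of the `𝔪`-adic completion `R̂` of a noetherian local ring `(R, 𝔪)` containing a
power of `𝔪̂ = 𝔪R̂` is extended from `R`: `J = (J ∩ R)·R̂`. (Write `x ∈ J` as `x = r + y` with
`r ∈ R` and `y ∈ 𝔪ᴺR̂ = ker (R̂ → R/𝔪ᴺ)`; then `r ∈ J ∩ R`.) An immediate consequence of
"`Â/𝔪ⁿÂ = A/𝔪ⁿ` for all `n > 0`" and "`IÂ ∩ A = I`" [Matsumura, *Commutative Ring Theory*, §8,
summary for local noetherian rings, items (3)–(4), p. 63], here obtained from Mathlib's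
`AdicCompletion.pow_smul_top_eq_ker_eval` (`𝔪ⁿR̂ = ker (R̂ → R/𝔪ⁿ)`); recorded because the transfer
`ca(R̂) = ca(R)·R̂` below rests on it. [cite: Matsumura1987, §8 summary (3)–(4), p. 63 (consequence)] -/
theorem eq_map_comap_of_maximalIdeal_pow_le {R : Type u} [CommRing R] [IsNoetherianRing R]
    [IsLocalRing R] {J : Ideal (AdicCompletion (maximalIdeal R) R)} {N : ℕ}
    (hJ : maximalIdeal (AdicCompletion (maximalIdeal R) R) ^ N ≤ J) :
    J = (J.comap (algebraMap R (AdicCompletion (maximalIdeal R) R))).map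
      (algebraMap R (AdicCompletion (maximalIdeal R) R)) := by
  have hfg : (maximalIdeal R).FG := (maximalIdeal R).fg_of_isNoetherianRing
  have hpow : (maximalIdeal R ^ N).map (algebraMap R (AdicCompletion (maximalIdeal R) R)) =
      maximalIdeal (AdicCompletion (maximalIdeal R) R) ^ N := by
    rw [Ideal.map_pow, AdicCompletion.maximalIdeal_eq_map]
  have hle : maximalIdeal R ^ N ≤ J.comap (algebraMap R (AdicCompletion (maximalIdeal R) R)) := by
    rw [← Ideal.map_le_iff_le_comap, hpow]
    exact hJ
  refine le_antisymm ?_ Ideal.map_comap_le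
  intro x hx
  obtain ⟨r, hr⟩ := Submodule.Quotient.mk_surjective _ (x.val N)
  have hker : x - algebraMap R (AdicCompletion (maximalIdeal R) R) r ∈
      LinearMap.ker (AdicCompletion.eval (maximalIdeal R) R N) := by
    rw [LinearMap.mem_ker, map_sub, sub_eq_zero, AdicCompletion.eval_apply,
      AdicCompletion.eval_apply, AdicCompletion.algebraMap_apply, AdicCompletion.of_apply,
      Submodule.mkQ_apply, Algebra.algebraMap_self, RingHom.id_apply]
    exact hr.symm
  have hmem : x - algebraMap R (AdicCompletion (maximalIdeal R) R) r ∈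
      (maximalIdeal R ^ N).map (algebraMap R (AdicCompletion (maximalIdeal R) R)) := by
    rw [← AdicCompletion.pow_smul_top_eq_ker_eval (M := R) hfg, Ideal.smul_top_eq_map,
      Submodule.restrictScalars_mem] at hker
    exact hker
  have hxr : algebraMap R (AdicCompletion (maximalIdeal R) R) r ∈ J := by
    have h' : x - (x - algebraMap R (AdicCompletion (maximalIdeal R) R) r) ∈ J :=
      J.sub_mem hx (hJ (hpow ▸ hmem))
    simpa using h'
  have hx' : x = algebraMap R (AdicCompletion (maximalIdeal R) R) r +
      (x - algebraMap R (AdicCompletion (maximalIdeal R) R) r) := by ring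
  rw [hx']
  exact Ideal.add_mem _ (Ideal.mem_map_of_mem _ (Ideal.mem_comap.mpr hxr))
    (Ideal.map_mono hle hmem)

/-! ## Named facts: Theorem 4.5 -/

/-- NAMED FACT — **[BahlekehHakimianSalarianTakahashi2015, Theorem 4.5 (1)]**: "Let `R` be a
`d`-dimensional local ring. Let `n ≥ 0` be an integer. (1) One has `caⁿ(R̂) ∩ R ⊆ caⁿ(R)`."
(Here `R` is commutative noetherian local, Convention 2.1; `R̂` its `𝔪`-adic completion; the
proof: `Ext_R̂ⁿ(M̂, N̂)` is the completion of `Ext_Rⁿ(M, N)` and `R → R̂` is faithfully flat, hence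
pure.) Rendered with `R̂ = AdicCompletion (maximalIdeal R) R` and `∩ R` = `Ideal.comap` of the
structure map; the dimension plays no role in (1). Users take `(h : caCompletion_comap_le)`.
[cite: BahlekehHakimianSalarianTakahashi2015, Theorem 4.5 (1)] -/
def caCompletion_comap_le : Prop :=
  ∀ (R : Type u) [CommRing R] [IsNoetherianRing R] [IsLocalRing R] (n : ℕ),
    (cohomologyAnnihilatorOfDegree (AdicCompletion (maximalIdeal R) R) n).comap
        (algebraMap R (AdicCompletion (maximalIdeal R) R)) ≤
      cohomologyAnnihilatorOfDegree R n

/-- NAMED FACT — **[BahlekehHakimianSalarianTakahashi2015, Theorem 4.5 (2)]**: "Let `R` be a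
`d`-dimensional local ring. Let `n ≥ 0` be an integer. (2) Suppose that `R̂` is an isolated
singularity. Then `caⁿ(R) ⊆ caⁿ⁺ᵈ(R̂) ∩ R`." (Proof in the source via its Cor. 4.4: every module in
`mod₀ R̂` is a direct summand of the completion of a module in `mod₀ R`.) Rendered with
`d = ringKrullDim R`, `R̂ = AdicCompletion (maximalIdeal R) R`, `IsIsolatedSingularity R̂`, and
`∩ R` = `Ideal.comap` of the structure map. Users take `(h : le_caCompletion_comap)`.
[cite: BahlekehHakimianSalarianTakahashi2015, Theorem 4.5 (2)] -/
def le_caCompletion_comap : Prop :=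
  ∀ (R : Type u) [CommRing R] [IsNoetherianRing R] [IsLocalRing R] (d : ℕ), ringKrullDim R = d →
    IsIsolatedSingularity (AdicCompletion (maximalIdeal R) R) → ∀ n : ℕ,
      cohomologyAnnihilatorOfDegree R n ≤
        (cohomologyAnnihilatorOfDegree (AdicCompletion (maximalIdeal R) R) (n + d)).comap
          (algebraMap R (AdicCompletion (maximalIdeal R) R))

/-! ## Consequences of Theorem 4.5 (proved modulo the two named facts) -/

/-- **[BahlekehHakimianSalarianTakahashi2015, Theorem 4.5 (2)], "Hence `ca(R) = ca(R̂) ∩ R`"** —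
PROVED from the two named facts `caCompletion_comap_le` (part (1)) and `le_caCompletion_comap`
(part (2)): for a noetherian local ring `R` of Krull dimension `d` whose completion is an isolated
singularity, `ca(R)` is the contraction of `ca(R̂)`.
[cite: BahlekehHakimianSalarianTakahashi2015, Theorem 4.5 (2)] -/
theorem cohomologyAnnihilator_eq_comap_completion (h₁ : caCompletion_comap_le.{u})
    (h₂ : le_caCompletion_comap.{u}) {R : Type u} [CommRing R] [IsNoetherianRing R]
    [IsLocalRing R] {d : ℕ} (hd : ringKrullDim R = d)
    (hiso : IsIsolatedSingularity (AdicCompletion (maximalIdeal R) R)) :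
    cohomologyAnnihilator R =
      (cohomologyAnnihilator (AdicCompletion (maximalIdeal R) R)).comap
        (algebraMap R (AdicCompletion (maximalIdeal R) R)) := by
  refine le_antisymm ?_ ?_
  · intro x hx
    obtain ⟨n, hn⟩ := mem_cohomologyAnnihilator_iff.mp hx
    have hx' := h₂ R d hd hiso n hn
    rw [Ideal.mem_comap] at hx' ⊢
    exact cohomologyAnnihilatorOfDegree_le (n + d) hx'
  · intro x hx
    rw [Ideal.mem_comap] at hx
    obtain ⟨n, hn⟩ := mem_cohomologyAnnihilator_iff.mp hx
    exact cohomologyAnnihilatorOfDegree_le n (h₁ R n (Ideal.mem_comap.mpr hn))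

/-- **[BahlekehHakimianSalarianTakahashi2015, Theorem 4.5], "In particular, `ca(R)` is `𝔪`-primary
if and only if `ca(R̂)` is `𝔪̂`-primary"** — PROVED from the two named facts, in the form
`(∃ N, 𝔪ᴺ ⊆ ca(R)) ↔ (∃ N, 𝔪̂ᴺ ⊆ ca(R̂))` ("primary to the maximal ideal, or the unit ideal", which
is what the source's usage means; `𝔪̂ = 𝔪R̂` by `AdicCompletion.maximalIdeal_eq_map`).
[cite: BahlekehHakimianSalarianTakahashi2015, Theorem 4.5 (2)] -/
theorem exists_pow_le_cohomologyAnnihilator_iff (h₁ : caCompletion_comap_le.{u})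
    (h₂ : le_caCompletion_comap.{u}) {R : Type u} [CommRing R] [IsNoetherianRing R]
    [IsLocalRing R] {d : ℕ} (hd : ringKrullDim R = d)
    (hiso : IsIsolatedSingularity (AdicCompletion (maximalIdeal R) R)) :
    (∃ N : ℕ, maximalIdeal R ^ N ≤ cohomologyAnnihilator R) ↔
      ∃ N : ℕ, maximalIdeal (AdicCompletion (maximalIdeal R) R) ^ N ≤
        cohomologyAnnihilator (AdicCompletion (maximalIdeal R) R) := by
  have hc := cohomologyAnnihilator_eq_comap_completion h₁ h₂ hd hiso
  constructor
  · rintro ⟨N, hN⟩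
    refine ⟨N, ?_⟩
    rw [AdicCompletion.maximalIdeal_eq_map, ← Ideal.map_pow, Ideal.map_le_iff_le_comap, ← hc]
    exact hN
  · rintro ⟨N, hN⟩
    refine ⟨N, ?_⟩
    rw [hc]
    refine le_trans ?_ (Ideal.comap_mono hN)
    rw [← Ideal.map_le_iff_le_comap, Ideal.map_pow, AdicCompletion.maximalIdeal_eq_map]

/-- **`ca(R̂) = ca(R)·R̂`** for a noetherian local ring `R` of Krull dimension `d` such that `R̂` is
an isolated singularity and `ca(R) ⊇ 𝔪ᴺ` for some `N` — PROVED from the two named facts of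
[BahlekehHakimianSalarianTakahashi2015, Thm. 4.5]: `ca(R̂) ⊇ ca(R)R̂ ⊇ 𝔪ᴺR̂ = 𝔪̂ᴺ`, so `ca(R̂)` is
extended from its contraction (`eq_map_comap_of_maximalIdeal_pow_le`), which is `ca(R)`
(`cohomologyAnnihilator_eq_comap_completion`). NOT a printed statement of the source (a one-step
consequence of Thm. 4.5, recorded for the specimen computations of the requesting route).
[cite: BahlekehHakimianSalarianTakahashi2015, Theorem 4.5 (consequence)] -/
theorem cohomologyAnnihilator_completion_eq_map (h₁ : caCompletion_comap_le.{u})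
    (h₂ : le_caCompletion_comap.{u}) {R : Type u} [CommRing R] [IsNoetherianRing R]
    [IsLocalRing R] {d : ℕ} (hd : ringKrullDim R = d)
    (hiso : IsIsolatedSingularity (AdicCompletion (maximalIdeal R) R))
    (hprim : ∃ N : ℕ, maximalIdeal R ^ N ≤ cohomologyAnnihilator R) :
    cohomologyAnnihilator (AdicCompletion (maximalIdeal R) R) =
      (cohomologyAnnihilator R).map (algebraMap R (AdicCompletion (maximalIdeal R) R)) := by
  have hc := cohomologyAnnihilator_eq_comap_completion h₁ h₂ hd hiso
  obtain ⟨N, hN⟩ := (exists_pow_le_cohomologyAnnihilator_iff h₁ h₂ hd hiso).mp hprim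
  conv_lhs => rw [eq_map_comap_of_maximalIdeal_pow_le hN, ← hc]

/-! ## Rings essentially of finite type over a field (with the tree's Theorem 5.4) -/

/-- For a LOCAL ring `R` which is a localisation of a finitely generated algebra over a field and an
isolated singularity, `ca(R)` contains a power of the maximal ideal — PROVED: by
[IyengarTakahashi2014, Thm. 5.4] (`singEqVCa_essFiniteType_holds`, proved in the tree)
`V(ca R) = Sing R`, and `Sing R ⊆ {𝔪}`. [cite: IyengarTakahashi2014, Thm. 5.4] -/
theorem exists_maximalIdeal_pow_le_cohomologyAnnihilator_of_essFiniteType {k : Type u} [Field k]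
    {A : Type u} [CommRing A] [Algebra k A] (hA : Algebra.FiniteType k A) {dA : ℕ}
    (hdA : ringKrullDim A = dA) (U : Submonoid A) {R : Type u} [CommRing R] [Algebra A R]
    (hU : IsLocalization U R) [IsNoetherianRing R] [IsLocalRing R]
    (hR : IsIsolatedSingularity R) :
    ∃ N : ℕ, maximalIdeal R ^ N ≤ cohomologyAnnihilator R := by
  refine exists_maximalIdeal_pow_le_of_isIsolatedSingularity hR fun 𝔭 _ hle => ?_
  have h := (singEqVCa_essFiniteType_holds k A hA dA hdA U R hU 𝔭).1
  rw [ca_eq_cohomologyAnnihilator] at h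
  exact h.mp hle

/-- **C-comp transfer for local rings essentially of finite type over a field** — PROVED modulo the
two named facts of [BahlekehHakimianSalarianTakahashi2015, Thm. 4.5]: if `R` is a local ring which
is a localisation of a finitely generated algebra over a field, `R` is an isolated singularity,
`dim R = d`, and `R̂` is an isolated singularity, then `ca(R̂) = ca(R)·R̂` and `ca(R) = ca(R̂) ∩ R`.
(The `𝔪`-primarity downstairs is [IyengarTakahashi2014, Thm. 5.4], proved in the tree.)
[cite: BahlekehHakimianSalarianTakahashi2015, Theorem 4.5 (consequence)] -/
theorem cohomologyAnnihilator_completion_eq_map_of_essFiniteType (h₁ : caCompletion_comap_le.{u})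
    (h₂ : le_caCompletion_comap.{u}) {k : Type u} [Field k] {A : Type u} [CommRing A]
    [Algebra k A] (hA : Algebra.FiniteType k A) {dA : ℕ} (hdA : ringKrullDim A = dA)
    (U : Submonoid A) {R : Type u} [CommRing R] [Algebra A R] (hU : IsLocalization U R)
    [IsNoetherianRing R] [IsLocalRing R] {d : ℕ} (hd : ringKrullDim R = d)
    (hR : IsIsolatedSingularity R)
    (hiso : IsIsolatedSingularity (AdicCompletion (maximalIdeal R) R)) :
    cohomologyAnnihilator (AdicCompletion (maximalIdeal R) R) =
        (cohomologyAnnihilator R).map (algebraMap R (AdicCompletion (maximalIdeal R) R)) ∧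
      cohomologyAnnihilator R =
        (cohomologyAnnihilator (AdicCompletion (maximalIdeal R) R)).comap
          (algebraMap R (AdicCompletion (maximalIdeal R) R)) :=
  ⟨cohomologyAnnihilator_completion_eq_map h₁ h₂ hd hiso
      (exists_maximalIdeal_pow_le_cohomologyAnnihilator_of_essFiniteType hA hdA U hU hR),
    cohomologyAnnihilator_eq_comap_completion h₁ h₂ hd hiso⟩

/-! ## Normal local rings of dimension ≤ 2 are isolated singularities -/

/-- **A normal noetherian local domain of Krull dimension `≤ 2` is an isolated singularity** —
PROVED: a non-maximal prime `𝔭` of a local ring of dimension `≤ 2` has height `≤ 1`, so `R_𝔭` is a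
normal noetherian local domain of dimension `≤ 1`, hence a field or a DVR
([Matsumura1987, Thm. 11.2, (4) ⇒ (1)]: "a one-dimensional normal Noetherian local ring is a
DVR"), in either case regular (via Mathlib: `R_𝔭` is a Dedekind domain, hence a regular ring). This
is the form in which the stages of the requesting route's `ca`-tower (normal, two-dimensional) meet
the hypothesis `IsIsolatedSingularity` of the transfer theorems above.
[cite: Matsumura1987, Theorem 11.2 (4)⇒(1) (consequence)] -/
theorem isIsolatedSingularity_of_isIntegrallyClosed_of_ringKrullDim_le_two {R : Type u}
    [CommRing R] [IsDomain R] [IsNoetherianRing R] [IsLocalRing R] [IsIntegrallyClosed R]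
    (hdim : ringKrullDim R ≤ 2) : IsIsolatedSingularity R := by
  intro 𝔭 _ hne
  -- `height 𝔭 ≤ 1`
  have hlt : 𝔭 < maximalIdeal R :=
    lt_of_le_of_ne (IsLocalRing.le_maximalIdeal Ideal.IsPrime.ne_top') hne
  have hh : 𝔭.height < (maximalIdeal R).height :=
    Ideal.height_strict_mono_of_isPrime_of_isPrime hlt
  have hm : ((maximalIdeal R).height : WithBot ℕ∞) ≤ 2 := by
    rw [IsLocalRing.maximalIdeal_height_eq_ringKrullDim]
    exact hdim
  have hp1 : 𝔭.height ≤ 1 := by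
    have hm' : (maximalIdeal R).height ≤ 2 := by
      rw [← WithBot.coe_le_coe]
      exact hm
    have h2 : 𝔭.height < 2 := lt_of_lt_of_le hh hm'
    have hne' : 𝔭.height ≠ ⊤ := ne_top_of_lt h2
    lift 𝔭.height to ℕ using hne' with n hn
    · norm_cast at h2 ⊢
      omega
  -- the localisation `R_𝔭`: a normal noetherian local domain of dimension `≤ 1`
  haveI : IsIntegrallyClosed (Localization.AtPrime 𝔭) :=
    isIntegrallyClosed_of_isLocalization (Localization.AtPrime 𝔭) 𝔭.primeCompl
      𝔭.primeCompl_le_nonZeroDivisors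
  haveI : Ring.KrullDimLE 1 (Localization.AtPrime 𝔭) := by
    rw [Ring.krullDimLE_iff, IsLocalization.AtPrime.ringKrullDim_eq_height 𝔭]
    exact_mod_cast hp1
  haveI : Ring.DimensionLEOne (Localization.AtPrime 𝔭) :=
    ⟨fun hp hprime => hprime.isMaximal_of_ne_bot hp⟩
  haveI : IsDedekindRing (Localization.AtPrime 𝔭) :=
    { (inferInstance : IsNoetherian (Localization.AtPrime 𝔭) (Localization.AtPrime 𝔭)),
      ‹Ring.DimensionLEOne (Localization.AtPrime 𝔭)›,
      ‹IsIntegrallyClosed (Localization.AtPrime 𝔭)› with }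
  exact IsRegularLocalRing.of_isRegularRing_of_isLocalRing (Localization.AtPrime 𝔭)

/-- **C-comp transfer for the normal two-dimensional stages of the route** — PROVED modulo the two
named facts of [BahlekehHakimianSalarianTakahashi2015, Thm. 4.5]: for a NORMAL local domain `R` of
Krull dimension `≤ 2` which is a localisation of a finitely generated algebra over a field and whose
completion `R̂` is an isolated singularity, `ca(R̂) = ca(R)·R̂` and `ca(R) = ca(R̂) ∩ R`
(`cohomologyAnnihilator_completion_eq_map_of_essFiniteType` with
`isIsolatedSingularity_of_isIntegrallyClosed_of_ringKrullDim_le_two`).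
[cite: BahlekehHakimianSalarianTakahashi2015, Theorem 4.5 (consequence)] -/
theorem cohomologyAnnihilator_completion_eq_map_of_isIntegrallyClosed
    (h₁ : caCompletion_comap_le.{u}) (h₂ : le_caCompletion_comap.{u}) {k : Type u} [Field k]
    {A : Type u} [CommRing A] [Algebra k A] (hA : Algebra.FiniteType k A) {dA : ℕ}
    (hdA : ringKrullDim A = dA) (U : Submonoid A) {R : Type u} [CommRing R] [IsDomain R]
    [Algebra A R] (hU : IsLocalization U R) [IsNoetherianRing R] [IsLocalRing R]
    [IsIntegrallyClosed R] {d : ℕ} (hd : ringKrullDim R = d) (hd2 : d ≤ 2)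
    (hiso : IsIsolatedSingularity (AdicCompletion (maximalIdeal R) R)) :
    cohomologyAnnihilator (AdicCompletion (maximalIdeal R) R) =
        (cohomologyAnnihilator R).map (algebraMap R (AdicCompletion (maximalIdeal R) R)) ∧
      cohomologyAnnihilator R =
        (cohomologyAnnihilator (AdicCompletion (maximalIdeal R) R)).comap
          (algebraMap R (AdicCompletion (maximalIdeal R) R)) :=
  cohomologyAnnihilator_completion_eq_map_of_essFiniteType h₁ h₂ hA hdA U hU hd
    (isIsolatedSingularity_of_isIntegrallyClosed_of_ringKrullDim_le_two
      (by rw [hd]; exact_mod_cast hd2))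
    hiso

end Literature.RingTheory.CohomologyAnnihilator

end
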